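import Literature.NumberTheory.Automorphic.PartialAsaiLHolomorphy
import Literature.NumberTheory.Automorphic.AsaiAtOneOfMoeglinWaldspurger
import HarnessLib

/-!
# Grbac–Shahidi 2015, Thm. 4.3 at `s = 1` (`GrbacShahidi2015_partialAsaiL_at_one`) from the NAMED
# FACTS of the tree: `GrbacShahidi2015_partialAsaiL_holomorphy` and either Mœglin–Waldspurger's
# Corollaire (ii) or the Jacquet–Shalika facts

Topic `NumberTheory/Automorphic`; namespace `Literature.NumberTheory.Automorphic`.  Proof file
(theorems only: no definition, no named fact, no instance) of the provefact unit
`GrbacShahidi2015_partialAsaiL_at_one` (ninth session, 2026-08-16).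

## What this file does

The named fact `GrbacShahidi2015_partialAsaiL_at_one` (`AsaiSignContinuation`: for a cuspidal `Π` on
`GL_N(𝔸_E)`, `E/F` quadratic, unitary almost everywhere, every Asai datum `(S, A)` and sign `η`, the
partial Asai `L`-function `L^S(s, Π, As^η)` converges far to the right and `(s - 1)^k L^S(s, Π, As^η)`,
`k ≤ 1`, continues holomorphically to `{1 < Re s} ∪ B(1, δ)` with a NON-ZERO value at `s = 1`) is
Grbac–Shahidi's Theorem 4.3 read at `s = 1`.  The accepted files `AsaiAtOneOfHolomorphy`,
`AsaiAtOneOfL2`, `AsaiAtOneOfAsaiHolomorphy` and `AsaiAtOneOfMoeglinWaldspurger` prove it from the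
HOLOMORPHY clauses (1), (2)(a) of that theorem — taken there as an explicit hypothesis `hGS`, because
no declaration of the tree stated them — plus Rankin–Selberg inputs.  Since librarian sweep g27 the
holomorphy clauses ARE a declaration of the tree: the named fact
`GrbacShahidi2015_partialAsaiL_holomorphy` of `PartialAsaiLHolomorphy` (verbatim `hGS`).  This file
records the two resulting implications BETWEEN NAMED FACTS, so that the discharge
`GrbacShahidi2015_partialAsaiL_at_one_holds` is the one-line application of either theorem below to
the `_holds` theorems of its inputs, once those exist:

* `GrbacShahidi2015_partialAsaiL_at_one_of_facts` —
  `GrbacShahidi2015_partialAsaiL_holomorphy → (∀ E N μ, MoeglinWaldspurger1989_partialPairL_of_eq_conj) →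
   GrbacShahidi2015_partialAsaiL_at_one`
  (two named facts; the Rankin–Selberg input at `s = 1` is re-derived from the continuations by
  de la Vallée Poussin positivity and Landau's lemma, the cross term `L(s, Π₀ × Π₀^c) = L(As⁺) L(As⁻)`
  being continued by the Asai fact itself: `AsaiAtOneOfMoeglinWaldspurger`);
* `GrbacShahidi2015_partialAsaiL_at_one_of_facts_jacquetShalika` —
  `GrbacShahidi2015_partialAsaiL_holomorphy →` Arthur–Clozel (2.2) at `s = 1`
  (`JacquetShalika1981_partialPairL_at_one_of_ne_conj`), (2.2) on `Re s = 1` off `s = 1`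
  (`JacquetShalika1981_partialPairL_boundary_of_ne_one`, equal ranks, one measure), (2.3)
  (`JacquetShalika1981_partialPairL_pole_of_eq_conj`) and `multiplicity_one_gl` `→`
  `GrbacShahidi2015_partialAsaiL_at_one` (Grbac–Shahidi's own route, proof of Thm. 4.3, pp. 205–206,
  Remark 4.4: `AsaiAtOneOfAsaiHolomorphy`);
* `GrbacShahidi2015_partialAsaiL_holomorphy.exists_continuation_sub_one_mul` — under the fact,
  `(s - 1) L^S(s, Π₀, As^η)` continues holomorphically to `ℂ ∖ {0}` (`G / s`), the shape consumed by
  the `s = 1` statements.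

Nothing here is new mathematics; the point is that every hypothesis is now a declaration of the tree.
What is still missing for `GrbacShahidi2015_partialAsaiL_at_one_holds`: a proof of
`GrbacShahidi2015_partialAsaiL_holomorphy` (the Langlands–Shahidi method on `U(N, N)` and Mok's
endoscopic classification, Grbac–Shahidi Thm. 2.1, 4.1, 4.3; for `As⁺` also Flicker 1988) and of
`MoeglinWaldspurger1989_partialPairL_of_eq_conj` (or of the four Jacquet–Shalika / multiplicity-one
facts) beyond the low ranks where the tree proves them.

## References

* N. Grbac, F. Shahidi, *Endoscopic transfer for unitary groups and holomorphy of Asai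
  `L`-functions*, Pacific J. Math. 276 (2015), 185–211: Thm. 4.3 (pp. 186, 204), its proof
  pp. 204–206, Remark 4.4. [GrbacShahidi2015]
* C. Mœglin, J.-L. Waldspurger, *Le spectre résiduel de `GL(n)`*, Ann. Sci. ÉNS (4) 22 (1989),
  Appendice, Corollaire (ii), p. 667. [MoeglinWaldspurger1989]
* J. Arthur, L. Clozel, *Simple algebras, base change, and the advanced theory of the trace formula*,
  Ann. of Math. Stud. 120 (1989), Ch. 3 §2 (2.1)–(2.3). [ArthurClozelAMS120]
-/

noncomputable section

open scoped Topology
open NumberField IsDedekindDomain Filter MeasureTheory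

namespace Literature.NumberTheory.Automorphic

open AdelicGroupData

/-- **Under the fact, `(s - 1) L^S(s, Π₀, As^η)` continues holomorphically to `ℂ ∖ {0}`** (`G / s`
for the entire `G = s (s - 1) L^S` of `GrbacShahidi2015_partialAsaiL_holomorphy`) — in particular to
the neighbourhoods `{1 < Re s} ∪ B(1, δ)`, `δ ≤ 1`, of `GrbacShahidi2015_partialAsaiL_at_one`.
[cite: GrbacShahidi2015, Thm. 4.3 (2)(a), pp. 186 and 204] -/
theorem GrbacShahidi2015_partialAsaiL_holomorphy.exists_continuation_sub_one_mul
    (hGS : GrbacShahidi2015_partialAsaiL_holomorphy)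
    {F E : Type} [Field F] [NumberField F] [Field E] [NumberField E] [Algebra F E]
    {c : E ≃ₐ[F] E} (h2 : Module.finrank F E = 2) (hc : c ≠ 1)
    {N : ℕ} {μ : Measure (gl N E).automorphicQuotient} [(gl N E).IsAutomorphicMeasure μ]
    (P : CuspidalAutomorphicRepGL N E μ) (hN : 0 < N)
    {S : Set (HeightOneSpectrum (𝓞 F))} {A : SatakeFamily E} (η : ℤˣ) (hS : S.Finite)
    (hA : IsSatakeFamilyOf P {w : HeightOneSpectrum (𝓞 E) | w.under (𝓞 F) ∈ S} A)
    (hinert : ∀ w : HeightOneSpectrum (𝓞 E), w.under (𝓞 F) ∉ S → c • w = w →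
      w.asIdeal.inertiaDeg (𝓞 F) = 2) :
    ∃ σ₀ : ℝ, 1 ≤ σ₀ ∧ ∃ G : ℂ → ℂ, DifferentiableOn ℂ G {s : ℂ | s ≠ 0} ∧
      ∀ s : ℂ, σ₀ < s.re → G s = (s - 1) * partialAsaiL S c A η s := by
  obtain ⟨σ₀, hσ₀, ⟨G, hG, hGL⟩, -⟩ := hGS F E c h2 hc N μ P hN S A η hS hA hinert
  refine ⟨σ₀, hσ₀, fun s => G s / s,
    fun s hs => ((hG s).div differentiableAt_id hs).differentiableWithinAt, fun s hs => ?_⟩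
  have hs0 : s ≠ 0 := by
    intro h
    rw [h, Complex.zero_re] at hs
    linarith
  show G s / s = (s - 1) * partialAsaiL S c A η s
  rw [hGL s hs, mul_assoc, mul_div_cancel_left₀ _ hs0]

/-- **Grbac–Shahidi 2015, Thm. 4.3 at `s = 1`, from the two named facts
`GrbacShahidi2015_partialAsaiL_holomorphy` and `MoeglinWaldspurger1989_partialPairL_of_eq_conj`.**
The named fact `GrbacShahidi2015_partialAsaiL_at_one` (`AsaiSignContinuation`) follows from the
holomorphy clauses (1), (2)(a) of Thm. 4.3 in `L²_cusp` (`PartialAsaiLHolomorphy`) and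
Mœglin–Waldspurger's Corollaire (ii) (`s (s - 1) L^S(s, π ⊗ π̄)` entire; over every number field,
in every rank, for every automorphic measure) — the accepted theorem
`GrbacShahidi2015_partialAsaiL_at_one_of_asaiHolomorphy_of_moeglinWaldspurger`: Borel–Jacquet
dictionary `Π ↔ Π₀ ⊗ |det|^z`, order count `(∗∗)` at `s = 1` through
`L^{S_E}(s, Π₀ × Π₀^c) = L^S(s, Π₀, As⁺) L^S(s, Π₀, As⁻)`, the non-vanishing of this cross term on
`Re s = 1` by positivity and Landau's lemma with the diagonal continuations from Corollaire (ii).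
[cite: GrbacShahidi2015, Thm. 4.3 and its proof, pp. 204–206, Remark 4.4]
[cite: MoeglinWaldspurger1989, Appendice, Corollaire (ii), p. 667] -/
theorem GrbacShahidi2015_partialAsaiL_at_one_of_facts
    (hGS : GrbacShahidi2015_partialAsaiL_holomorphy)
    (hMW : ∀ (E : Type) [Field E] [NumberField E] (N : ℕ)
      (μ : Measure (gl N E).automorphicQuotient) [(gl N E).IsAutomorphicMeasure μ],
      MoeglinWaldspurger1989_partialPairL_of_eq_conj (n := N) (K := E) (μ := μ)) :
    GrbacShahidi2015_partialAsaiL_at_one :=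
  GrbacShahidi2015_partialAsaiL_at_one_of_asaiHolomorphy_of_moeglinWaldspurger hGS hMW

/-- **Grbac–Shahidi 2015, Thm. 4.3 at `s = 1`, from `GrbacShahidi2015_partialAsaiL_holomorphy` and the
Jacquet–Shalika facts** (Grbac–Shahidi's own route, proof of Thm. 4.3, pp. 205–206, Remark 4.4:
"once the holomorphy … is known at some `s₀` …, the argument using the Rankin–Selberg `L`-function …
can be applied directly to obtain nonvanishing").  The named fact `GrbacShahidi2015_partialAsaiL_at_one`
follows from `GrbacShahidi2015_partialAsaiL_holomorphy` and the tree's named `L²` facts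
`JacquetShalika1981_partialPairL_at_one_of_ne_conj` (Arthur–Clozel (2.2) at `s = 1`),
`JacquetShalika1981_partialPairL_boundary_of_ne_one` ((2.2) on `Re s = 1` off `s = 1`, equal ranks,
one measure), `JacquetShalika1981_partialPairL_pole_of_eq_conj` ((2.3)) and `multiplicity_one_gl`
(over every number field, in every rank, for every automorphic measure) — the accepted theorem
`GrbacShahidi2015_partialAsaiL_at_one_of_asaiHolomorphy_of_L2` of `AsaiAtOneOfAsaiHolomorphy`.
[cite: GrbacShahidi2015, Thm. 4.3 and its proof, pp. 204–206, Remark 4.4]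
[cite: ArthurClozelAMS120, Ch. 3 §2 (2.1)–(2.3)] -/
theorem GrbacShahidi2015_partialAsaiL_at_one_of_facts_jacquetShalika
    (hGS : GrbacShahidi2015_partialAsaiL_holomorphy)
    (h22 : ∀ (E : Type) [Field E] [NumberField E] (N : ℕ)
      (μ : Measure (gl N E).automorphicQuotient) [(gl N E).IsAutomorphicMeasure μ],
      JacquetShalika1981_partialPairL_at_one_of_ne_conj (n := N) (K := E) (μ := μ))
    (h22' : ∀ (E : Type) [Field E] [NumberField E] (N : ℕ)
      (μ : Measure (gl N E).automorphicQuotient) [(gl N E).IsAutomorphicMeasure μ],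
      JacquetShalika1981_partialPairL_boundary_of_ne_one (n := N) (m := N) (K := E) (μ := μ)
        (μ' := μ))
    (h23 : ∀ (E : Type) [Field E] [NumberField E] (N : ℕ)
      (μ : Measure (gl N E).automorphicQuotient) [(gl N E).IsAutomorphicMeasure μ],
      JacquetShalika1981_partialPairL_pole_of_eq_conj (n := N) (K := E) (μ := μ))
    (hm1 : ∀ (E : Type) [Field E] [NumberField E] (N : ℕ)
      (μ : Measure (gl N E).automorphicQuotient) [(gl N E).IsAutomorphicMeasure μ],
      multiplicity_one_gl N E μ) :
    GrbacShahidi2015_partialAsaiL_at_one :=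
  GrbacShahidi2015_partialAsaiL_at_one_of_asaiHolomorphy_of_L2 hGS h22 h22' h23 hm1

end Literature.NumberTheory.Automorphic

end
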